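import Literature.NumberTheory.GaloisRepresentations.IdeleClassModUnitsSInvariant
import Literature.NumberTheory.GaloisRepresentations.IdeleClassModUnitsSInflation
import HarnessLib

/-!
# The invariant maps of the `S`-idèle class layers in a tower `F ⊆ E ⊆ M`:
# `Inf ū_{E/F} = [M:E] · ū_{M/F}` and `inv_S ∘ Inf = inv_S`, absolutely and at the relative layers
# (Harari Def. 16.3 / Thm. 17.2 / Lemma 16.20; Serre XI §2 Prop. 1, §3; NSW (8.3.9))

Topic `NumberTheory/GaloisRepresentations`; namespace `Literature.NumberTheory.GaloisRepresentations.IdeleCohomology`.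
THEOREMS ONLY (no definition, no named fact, no instance, no notation, no `sorry`; number fields in `Type`).  Sequel of
`IdeleClassModUnitsSInvariant` (THE class `ū_{E/F} = fundamentalClassModUnits F E S`, THE invariant map
`classModUnitsInv S hS = inv_{E/F} ∘ (H²(π))⁻¹`, the relative invariants `invSub H` at `H ≤ Gal(E/F)`) and of w4 g19's
`IdeleClassModUnitsSInflation` (the transition `classModUnitsInflHom F E M S : Res C_S(E) ⟶ C_S(M)` of
`C_S = lim→ C_S(E)`, `classModUnitsInf`, `map_π_comp_classModUnitsInf`) and `ClassModuleQuotientLayerTower`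
(`map_subtype_map_eq_map_map_subtype`: restriction commutes with inflation).

THE POINT.  The invariant map `inv_S : H²(G_S, C_S) → ℚ/ℤ` of Harari's `P`-class formation `(G_S, C_S)` (Thm. 17.2)
is DEFINED on `H²(G_S, C_S) = lim→_{E ⊂ F_S} H²(Gal(E/F), C_S(E))` by the layer invariants `inv_{E/F,S}`, which requires
their compatibility with the transitions — `inv_{M/F,S} ∘ Inf = inv_{E/F,S}` (§1, from the tree's `inv_{M/F} ∘ Inf =
inv_{E/F}`, `classInvAll_classInf`, through `H²(π)`), resting on the tower law for THE classes `Inf ū_{E/F} =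
[M:E] · ū_{M/F}` (from `classInf_fundamentalClassAll`).  At an open subgroup `U ≤ G_S` the same is needed for the
RELATIVE layers `(H_E ≤ Gal(E/F), Res C_S(E))`, `H_E` the image of `U` (§2, in the currency of w4 g19's relative
vanishing lemma: `H_M ≤ Gal(M/F)`, `H_E ≤ Gal(E/F)`, `π' : H_M → H_E` over `res`, `j'` the transition on vectors):
`Inf' (res ū_{E/F}) = [M:E] · res ū_{M/F}` and `inv_{H_M} ∘ Inf' = inv_{H_E}` as soon as `|H_M| = [M:E] · |H_E|`
(both images of one `U` have index `[G_S : U]`) — the finite-level content of door-c6's `relLayerInv_stepG` for `C̄_S`.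

* §0 `eq_classModUnitsInflHom_of_sq`: ANY pair map `j : Res C_S(E) ⟶ C_S(M)` over the idèle-class base change
  (w4 g19's hypothesis `hsq`) IS `classModUnitsInflHom` (`C_E ↠ C_S(E)` is onto), so every statement below, proved for
  the transition, holds for such `j`.
* §1 `classModUnitsInf_iso_hom`, **`classModUnitsInf_fundamentalClassModUnits`**, **`classModUnitsInv_classModUnitsInf`**
  (+ `_map` forms for any `j`, `hsq`).
* §2 **`map_resFundamentalClassModUnits_eq_finrank_nsmul`**, **`invSub_classModUnits_map_relative`** (+ `_of_sq` forms).

Cell `bsd-eis`, background lane «PT-Ш-S-TC» of crux `GoodLatticeBDPValue` (stmt-BirchSwinnertonDyer-19032), brick D2-CF,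
seat bsd-line-x1-p1-w5 g10.  HONEST FRAMING: class field theory bookkeeping at finite layers; no duality theorem, no case of
Poitou–Tate and no case of BSD is proved here.

## References
* D. Harari, *Galois Cohomology and Class Field Theory* (2020), §16.1 Def. 16.3, §16.3 Lemma 16.20, §17.1 Thm. 17.2,
  §17.4 (17.1). [Harari2020]
* J.-P. Serre, *Local Fields*, GTM 67 (1979), XI §2 Prop. 1, §3. [SerreLocalFields1979]
* J. Neukirch, A. Schmidt, K. Wingberg, *Cohomology of Number Fields* (2nd ed. 2008), VIII §3 (8.3.8)–(8.3.10).
  [NeukirchSchmidtWingberg2008]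
* J. S. Milne, *Arithmetic Duality Theorems* (2nd ed. 2006), I §1, I §4. [MilneADT2006]
-/

noncomputable section

open NumberField IsDedekindDomain CategoryTheory CategoryTheory.Limits groupCohomology
open Literature.NumberTheory.Automorphic Literature.Algebra.Homology

namespace Literature.NumberTheory.GaloisRepresentations

namespace IdeleCohomology

variable {F E M : Type} [Field F] [NumberField F] [Field E] [NumberField E] [Field M] [NumberField M]
  [Algebra F E] [IsGalois F E] [Algebra F M] [IsGalois F M] [Algebra E M] [IsScalarTower F E M]
  (S : Finset (HeightOneSpectrum (𝓞 F)))

/-- A morphism of `ModuleCat ℤ` commutes with integer multiples (stated at this generality so that the instance paths are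
those of the cohomology objects). [folklore] -/
private theorem moduleCat_hom_zsmul {X Y : ModuleCat.{0} ℤ} (f : X ⟶ Y) (r : ℤ) (x : X) : f (r • x) = r • f x :=
  map_zsmul (ConcreteCategory.hom f) r x

/-- A morphism of `ModuleCat ℤ` commutes with natural multiples. [folklore] -/
private theorem moduleCat_hom_nsmul {X Y : ModuleCat.{0} ℤ} (f : X ⟶ Y) (m : ℕ) (x : X) : f (m • x) = m • f x :=
  map_nsmul (ConcreteCategory.hom f) m x

/-! ## §0. A pair map over the idèle-class base change is the transition -/

omit [IsGalois F M] in
/-- **A pair map `j : Res C_S(E) ⟶ C_S(M)` over the idèle-class base change IS the transition `classModUnitsInflHom`**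
(`C_E ↠ C_S(E)` is onto, so `j` is determined by the square `j ∘ π_E = π_M ∘ (C_E → C_M)`).
[cite: Harari2020, §17.4 (17.1)][cite: NeukirchSchmidtWingberg2008, VIII §3 (8.3.9)] -/
theorem eq_classModUnitsInflHom_of_sq
    (j : Rep.res (AlgEquiv.restrictNormalHom E) (classModUnitsRep F E S) ⟶ classModUnitsRep F M S)
    (hsq : ∀ c : (IdeleClassGroup.galoisRep F E).V,
      j.hom ((cokernel.π (unitsOffToClass (F := F) (E := E) S)).hom c) =
        (cokernel.π (unitsOffToClass (F := F) (E := M) S)).hom ((classInflHom F E M).hom c)) :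
    j = classModUnitsInflHom F E M S := by
  refine Rep.hom_ext (DFunLike.ext _ _ fun x => ?_)
  obtain ⟨c, rfl⟩ := cokernel_π_unitsOffToClass_surjective F E S x
  rw [hsq, classModUnitsInflHom_hom_apply_π]

/-! ## §1. `Inf ū_{E/F} = [M:E] · ū_{M/F}` and `inv_S ∘ Inf = inv_S` -/

/-- **`Inf_S ∘ H²(π_E) = H²(π_M) ∘ Inf`** on elements, through the isomorphisms `H²(π)` (w4 g19's
`map_π_comp_classModUnitsInf`). [cite: Harari2020, §17.1 Thm. 17.2 (proof)][cite: NeukirchSchmidtWingberg2008, VIII §3 (8.3.9)] -/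
theorem classModUnitsInf_iso_hom
    (hSE : ∀ v : HeightOneSpectrum (𝓞 F), v ∉ S → Algebra.IsUnramifiedIn (𝓞 E) v.asIdeal)
    (hSM : ∀ v : HeightOneSpectrum (𝓞 F), v ∉ S → Algebra.IsUnramifiedIn (𝓞 M) v.asIdeal)
    (n : ℕ) [NeZero n] (α : groupCohomology (IdeleClassGroup.galoisRep F E) n) :
    classModUnitsInf F E M S n ((groupCohomologyClassModUnitsIsoTop S hSE n).hom α) =
      (groupCohomologyClassModUnitsIsoTop S hSM n).hom (classInf F E M n α) := by
  have key : (groupCohomologyClassModUnitsIsoTop S hSE n).hom ≫ classModUnitsInf F E M S n =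
      classInf F E M n ≫ (groupCohomologyClassModUnitsIsoTop S hSM n).hom :=
    map_π_comp_classModUnitsInf F E M S n
  rw [← ModuleCat.comp_apply, key, ModuleCat.comp_apply]

/-- **The tower law for THE classes of the `S`-idèle class layers: `Inf ū_{E/F} = [M:E] · ū_{M/F}`** along the
transition `C_S(E) → C_S(M)` (from `Inf u_{E/F} = [M:E] · u_{M/F}`, the tree's `classInf_fundamentalClassAll`).
[cite: SerreLocalFields1979, Ch. XI §3][cite: NeukirchSchmidtWingberg2008, VIII §3 (8.3.8)] -/
theorem classModUnitsInf_fundamentalClassModUnits :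
    classModUnitsInf F E M S 2 (fundamentalClassModUnits F E S) =
      Module.finrank E M • fundamentalClassModUnits F M S := by
  have key := congrArg (fun φ => φ (fundamentalClassAll F E)) (map_π_comp_classModUnitsInf F E M S 2)
  simp only [ModuleCat.comp_apply] at key
  refine key.trans ?_
  change map (MonoidHom.id (M ≃ₐ[F] M)) (cokernel.π (unitsOffToClass (F := F) (E := M) S)) 2
    (classInf F E M 2 (fundamentalClassAll F E)) = _
  rw [classInf_fundamentalClassAll, moduleCat_hom_nsmul]
  rfl

omit [IsGalois F M] in
/-- The same along ANY pair map `j` over the base change (`j = classModUnitsInflHom`).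
[cite: SerreLocalFields1979, Ch. XI §3][cite: Harari2020, §17.4 (17.1)] -/
theorem map_fundamentalClassModUnits_eq_finrank_nsmul [IsGalois F M]
    (j : Rep.res (AlgEquiv.restrictNormalHom E) (classModUnitsRep F E S) ⟶ classModUnitsRep F M S)
    (hsq : ∀ c : (IdeleClassGroup.galoisRep F E).V,
      j.hom ((cokernel.π (unitsOffToClass (F := F) (E := E) S)).hom c) =
        (cokernel.π (unitsOffToClass (F := F) (E := M) S)).hom ((classInflHom F E M).hom c)) :
    map (AlgEquiv.restrictNormalHom E) j 2 (fundamentalClassModUnits F E S) =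
      Module.finrank E M • fundamentalClassModUnits F M S := by
  rw [eq_classModUnitsInflHom_of_sq S j hsq]
  exact classModUnitsInf_fundamentalClassModUnits S

/-- **`inv_S ∘ Inf = inv_S`**: the `S`-invariants of the layers `E ⊆ M` are compatible with the transition
`H²(Gal(E/F), C_S(E)) → H²(Gal(M/F), C_S(M))` (`S ⊇` the places ramified in `E/F` and in `M/F`) — from
`inv_{M/F} ∘ Inf = inv_{E/F}` (the tree's `classInvAll_classInf`).  This is the compatibility defining `inv_S` on
`H²(G_S, C_S) = lim→ H²(Gal(E/F), C_S(E))`. [cite: Harari2020, §16.1 Def. 16.3, §17.1 Thm. 17.2][cite: MilneADT2006, I §4] -/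
theorem classModUnitsInv_classModUnitsInf
    (hSE : ∀ v : HeightOneSpectrum (𝓞 F), v ∉ S → Algebra.IsUnramifiedIn (𝓞 E) v.asIdeal)
    (hSM : ∀ v : HeightOneSpectrum (𝓞 F), v ∉ S → Algebra.IsUnramifiedIn (𝓞 M) v.asIdeal)
    (y : groupCohomology (classModUnitsRep F E S) 2) :
    classModUnitsInv S hSM (classModUnitsInf F E M S 2 y) = classModUnitsInv S hSE y := by
  obtain ⟨α, rfl⟩ : ∃ α, (groupCohomologyClassModUnitsIsoTop S hSE 2).hom α = y :=
    ⟨(groupCohomologyClassModUnitsIsoTop S hSE 2).inv y, by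
      rw [← ModuleCat.comp_apply, Iso.inv_hom_id, ModuleCat.id_apply]⟩
  rw [classModUnitsInf_iso_hom S hSE hSM, classModUnitsInv_iso_hom, classModUnitsInv_iso_hom]
  exact classInvAll_classInf F E M α

/-- The same along ANY pair map `j` over the base change. [cite: Harari2020, §16.1 Def. 16.3, §17.4 (17.1)] -/
theorem classModUnitsInv_map_of_sq
    (j : Rep.res (AlgEquiv.restrictNormalHom E) (classModUnitsRep F E S) ⟶ classModUnitsRep F M S)
    (hsq : ∀ c : (IdeleClassGroup.galoisRep F E).V,
      j.hom ((cokernel.π (unitsOffToClass (F := F) (E := E) S)).hom c) =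
        (cokernel.π (unitsOffToClass (F := F) (E := M) S)).hom ((classInflHom F E M).hom c))
    (hSE : ∀ v : HeightOneSpectrum (𝓞 F), v ∉ S → Algebra.IsUnramifiedIn (𝓞 E) v.asIdeal)
    (hSM : ∀ v : HeightOneSpectrum (𝓞 F), v ∉ S → Algebra.IsUnramifiedIn (𝓞 M) v.asIdeal)
    (y : groupCohomology (classModUnitsRep F E S) 2) :
    classModUnitsInv S hSM (map (AlgEquiv.restrictNormalHom E) j 2 y) = classModUnitsInv S hSE y := by
  rw [eq_classModUnitsInflHom_of_sq S j hsq]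
  exact classModUnitsInv_classModUnitsInf S hSE hSM y

/-- `Inf` of a class of order dividing `e` in `H²(Gal(E/F), C_S(E))`: its invariant is unchanged, so a class with invariant
`t` at `E` yields a class with invariant `t` at every `M ⊇ E` (joint surjectivity of the layer invariants onto
`⋃_E (1/[E:F])ℤ/ℤ` is computed layer by layer). [cite: Harari2020, §17.1 Thm. 17.2] -/
theorem exists_classModUnitsInv_eq_of_layer
    (hSE : ∀ v : HeightOneSpectrum (𝓞 F), v ∉ S → Algebra.IsUnramifiedIn (𝓞 E) v.asIdeal)
    (hSM : ∀ v : HeightOneSpectrum (𝓞 F), v ∉ S → Algebra.IsUnramifiedIn (𝓞 M) v.asIdeal)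
    (t : AddCircle (1 : ℚ)) (ht : ∃ y : groupCohomology (classModUnitsRep F E S) 2, classModUnitsInv S hSE y = t) :
    ∃ z : groupCohomology (classModUnitsRep F M S) 2, classModUnitsInv S hSM z = t := by
  obtain ⟨y, rfl⟩ := ht
  exact ⟨classModUnitsInf F E M S 2 y, classModUnitsInv_classModUnitsInf S hSE hSM y⟩

/-! ## §2. The relative layers `H_E ≤ Gal(E/F)`, `H_M ≤ Gal(M/F)` over `res` -/

variable (H_M : Subgroup (M ≃ₐ[F] M)) (H_E : Subgroup (E ≃ₐ[F] E)) (π' : H_M →* H_E)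
  (hπ' : ∀ h : H_M, ((π' h : H_E) : E ≃ₐ[F] E) = AlgEquiv.restrictNormalHom E (h : M ≃ₐ[F] M))
  (j' : Rep.res π' (Rep.res H_E.subtype (classModUnitsRep F E S)) ⟶ Rep.res H_M.subtype (classModUnitsRep F M S))
  (hj' : ∀ a : (classModUnitsRep F E S).V, j'.hom a = (classModUnitsInflHom F E M S).hom a)

include hπ' hj' in
/-- **The relative inflation of the restricted classes: `Inf' (res_{H_E} ū_{E/F}) = [M:E] · res_{H_M} ū_{M/F}`**
(`res ∘ Inf = Inf' ∘ res`, w4 g19's `map_subtype_map_eq_map_map_subtype`, and §1).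
[cite: SerreLocalFields1979, Ch. XI §3][cite: Harari2020, §16.3 Lemma 16.20] -/
theorem map_resFundamentalClassModUnits_eq_finrank_nsmul :
    map π' j' 2 (resFundamentalClassModUnits S H_E) = Module.finrank E M • resFundamentalClassModUnits S H_M := by
  change map π' j' 2 (map H_E.subtype (𝟙 (Rep.res H_E.subtype (classModUnitsRep F E S))) 2
    (fundamentalClassModUnits F E S)) = _
  rw [← map_subtype_map_eq_map_map_subtype (AlgEquiv.restrictNormalHom E) (classModUnitsInflHom F E M S)
    H_M H_E π' hπ' j' hj' 2]
  change map H_M.subtype (𝟙 (Rep.res H_M.subtype (classModUnitsRep F M S))) 2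
    (classModUnitsInf F E M S 2 (fundamentalClassModUnits F E S)) = _
  rw [classModUnitsInf_fundamentalClassModUnits, moduleCat_hom_nsmul]

include hπ' hj' in
/-- **The relative `S`-invariants are compatible with the relative inflation: `inv_{H_M} (Inf' y) = inv_{H_E} (y)`**
for `y ∈ H²(H_E, C_S(E))`, provided `|H_M| = [M:E] · |H_E|` (the case of the images `H_E`, `H_M` of one open subgroup
`U ≤ G_S` in layers `E ⊆ M ⊂ F_S`, both of index `[G_S : U]`): `Inf' (r · res ū_E) = r [M:E] · res ū_M` has invariant
`r [M:E] / |H_M| = r / |H_E|`.  The finite-level content of the compatibility making the relative invariants a compatible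
family over the layers above `U` (door-c6's `relLayerInv_stepG`, for `C̄_S`).
[cite: SerreLocalFields1979, Ch. XI §2 Prop. 1, §3][cite: Harari2020, §16.3 Lemma 16.20] -/
theorem invSub_classModUnits_map_relative
    (hSE : ∀ v : HeightOneSpectrum (𝓞 F), v ∉ S → Algebra.IsUnramifiedIn (𝓞 E) v.asIdeal)
    (hSM : ∀ v : HeightOneSpectrum (𝓞 F), v ∉ S → Algebra.IsUnramifiedIn (𝓞 M) v.asIdeal)
    (hcard : Nat.card H_M = Module.finrank E M * Nat.card H_E)
    (y : groupCohomology (Rep.res H_E.subtype (classModUnitsRep F E S)) 2) :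
    (isClassModule_classModUnitsCocycle S hSM).invSub H_M (map π' j' 2 y) =
      (isClassModule_classModUnitsCocycle S hSE).invSub H_E y := by
  have hm : 0 < Module.finrank E M := by
    haveI : FiniteDimensional E M := Module.Finite.of_restrictScalars_finite F E M
    exact Module.finrank_pos
  obtain ⟨r, rfl⟩ := exists_zsmul_resFundamentalClassModUnits_eq S hSE H_E y
  have h1 : map π' j' 2 (r • resFundamentalClassModUnits S H_E) =
      r • (Module.finrank E M • resFundamentalClassModUnits S H_M) := by
    rw [moduleCat_hom_zsmul, map_resFundamentalClassModUnits_eq_finrank_nsmul S H_M H_E π' hπ' j' hj']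
  rw [h1, ← natCast_zsmul, ← mul_zsmul, invSub_classModUnits_zsmul_resFundamentalClassModUnits S hSM H_M,
    invSub_classModUnits_zsmul_resFundamentalClassModUnits S hSE H_E, hcard, mul_zsmul, natCast_zsmul,
    nsmul_oneDiv_mul hm]

variable (j'' : Rep.res π' (Rep.res H_E.subtype (classModUnitsRep F E S)) ⟶ Rep.res H_M.subtype (classModUnitsRep F M S))
  (j : Rep.res (AlgEquiv.restrictNormalHom E) (classModUnitsRep F E S) ⟶ classModUnitsRep F M S)
  (hsq : ∀ c : (IdeleClassGroup.galoisRep F E).V,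
    j.hom ((cokernel.π (unitsOffToClass (F := F) (E := E) S)).hom c) =
      (cokernel.π (unitsOffToClass (F := F) (E := M) S)).hom ((classInflHom F E M).hom c))
  (hj'' : ∀ a : (classModUnitsRep F E S).V, j''.hom a = j.hom a)

include hπ' hsq hj'' in
/-- `_of_sq` form of `map_resFundamentalClassModUnits_eq_finrank_nsmul`: `j'` agreeing on vectors with ANY pair map `j`
over the base change (w4 g19's `(j, hsq, j', hj')` data). [cite: SerreLocalFields1979, Ch. XI §3][cite: Harari2020, §16.3 Lemma 16.20] -/
theorem map_resFundamentalClassModUnits_eq_finrank_nsmul_of_sq :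
    map π' j'' 2 (resFundamentalClassModUnits S H_E) = Module.finrank E M • resFundamentalClassModUnits S H_M :=
  map_resFundamentalClassModUnits_eq_finrank_nsmul S H_M H_E π' hπ' j''
    (fun a => by rw [hj'', eq_classModUnitsInflHom_of_sq S j hsq])

include hπ' hsq hj'' in
/-- `_of_sq` form of `invSub_classModUnits_map_relative`. [cite: SerreLocalFields1979, Ch. XI §2 Prop. 1, §3][cite: Harari2020, §16.3 Lemma 16.20] -/
theorem invSub_classModUnits_map_relative_of_sq
    (hSE : ∀ v : HeightOneSpectrum (𝓞 F), v ∉ S → Algebra.IsUnramifiedIn (𝓞 E) v.asIdeal)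
    (hSM : ∀ v : HeightOneSpectrum (𝓞 F), v ∉ S → Algebra.IsUnramifiedIn (𝓞 M) v.asIdeal)
    (hcard : Nat.card H_M = Module.finrank E M * Nat.card H_E)
    (y : groupCohomology (Rep.res H_E.subtype (classModUnitsRep F E S)) 2) :
    (isClassModule_classModUnitsCocycle S hSM).invSub H_M (map π' j'' 2 y) =
      (isClassModule_classModUnitsCocycle S hSE).invSub H_E y :=
  invSub_classModUnits_map_relative S H_M H_E π' hπ' j''
    (fun a => by rw [hj'', eq_classModUnitsInflHom_of_sq S j hsq]) hSE hSM hcard y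

end IdeleCohomology

end Literature.NumberTheory.GaloisRepresentations

end
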